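import Literature.RingTheory.Smooth.AugmentationIdealCotangentBaseChange   -- ★ `tensorCotangentEquivOfAugmentation`, `baseChangeAugmentation`, `augIdealBaseChange`
import Mathlib.LinearAlgebra.Charpoly.BaseChange
import HarnessLib

/-!
# `T ⊗_R I/I² ≅ I_T/I_T²` is natural in augmented HOMOMORPHISMS `(S, ε) → (S', ε')`, and transports along augmented isomorphisms
# — the algebra of «the conormal module of a section commutes with base change, compatibly with the maps `w` of Görtz–Wedhorn II Rem. 17.14»

Topic `Literature/RingTheory/Smooth`, namespace `Literature.RingTheory.Smooth`.  DEFINITIONS (two linear equivalences assembled from Mathlib's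
`Ideal.mapCotangent` and ★ `tensorCotangentEquivOfAugmentation`) and THEOREMS; no instance, no notation, no named fact, no `sorry`.  Cell
`pub/hodgecm-mathlib` (D-0151), programme P6 «MOD», ROW 3 organ L3.1∕L3.2, brick **(D2c-ii-alg)** of A-p01 (g22): the algebra under the HONEST base change of
the cotangent characteristic polynomial of ★ `Morphisms/SectionConormalChart.sectionConormalEndo` (scheme side: `Morphisms/SectionConormalBaseChange`).

THE PRINT.  [GortzWedhorn2023] Remark 17.14: for a commutative square of pointed schemes the conormal modules of the sections carry a functorial map
`w`; Remark 17.15 (1) / [EGAIV4] (16.2.3 (ii)), (16.4.9): for a CARTESIAN square (base change `Spec T → Spec R`) the comparison `T ⊗_R 𝒞_e → 𝒞_{e_T}`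
is an isomorphism for a section (★ `tensorCotangentEquivOfAugmentation`, flatness not needed).  Here: that isomorphism is NATURAL in `w`.
★ `AugmentationIdealCotangentBaseChange` §4 proves the naturality for an augmented ENDOMORPHISM `g : S → S`; the map `w` of an endomorphism `v` of an
`R`-scheme read on a chart is NOT of that shape (it is `v^♯ : Γ(X, W) → Γ(X, D(h))` followed by the inverse of a localisation isomorphism), so the
scheme-side base change needs the version for a homomorphism between TWO augmented algebras, and the transport of `I_T/I_T²` along the augmented
`T`-algebra isomorphism `T ⊗_R Γ(X, W) ≅ Γ(X_T, p⁻¹W)` (★ `Morphisms/FibreChartRing.fibreChartIso`).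

PRIOR ART IN THE TREE (cited, not restated): ★ `AugmentationIdealCotangentBaseChange` §4 (endomorphism case of §1), A-p11's ★
`AugmentationIdealCotangentLocalizedBase.cotangentEquivOfEq` ∕ `tensorCotangentEquivAugIdealBaseChangeAugmentation` (the transport along the EQUALITY of
ideals `I·(T ⊗ S) = ker ε_T`, i.e. §3 at `Θ = id`), A-p14's ★ `AbelianScheme.cotangentChartBaseChangeEquiv` (§2 at one chart isomorphism, abelian schemes).

WHAT IS HERE (`ε : S →ₐ[R] R`, `ε' : S' →ₐ[R] R` augmentations, `T` a commutative `R`-algebra):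
* §1 augmented homomorphisms `g : S →ₐ[R] S'` (`ε' ∘ g = ε`): `augIdeal_le_comap_of_comp_eq`, `baseChangeAugmentation_comp_map`,
  `augIdealBaseChange_le_comap_map_of_comp_eq`, **`tensorCotangentEquivOfAugmentation_naturality_hom`** (★ §4 for `S ≠ S'`).
* §2 transport along an ALGEBRA ISOMORPHISM `Θ : B₁ ≃ₐ[A] B₂` with `Θ(I₁) ⊆ I₂`, `Θ⁻¹(I₂) ⊆ I₁`: **`cotangentEquivOfAlgEquiv : I₁/I₁² ≃ₗ[A] I₂/I₂²`**
  (`= Ideal.mapCotangent Θ`, inverse `Ideal.mapCotangent Θ⁻¹`), `_toCotangent`, and its naturality square `cotangentEquivOfAlgEquiv_naturality`.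
* §3 the MASTER SQUARE: for `Θ : T ⊗_R S ≃ₐ[T] S_Y`, `Θ' : T ⊗_R S' ≃ₐ[T] S_Y'` augmented (`ε_Y ∘ Θ = ε_T`, …) and `g_Y ∘ Θ = Θ' ∘ (T ⊗ g)`:
  `augIdealBaseChange_le_comap_algEquiv` ∕ `augIdeal_le_comap_algEquiv_symm` (`Θ(I_T) = I_Y`, ★ `ker_baseChangeAugmentation`),
  **`baseChangeCotangentEquiv ε T εY Θ hΘ : T ⊗_R I/I² ≃ₗ[T] I_Y/I_Y²`** (`_tmul`) and **`baseChangeCotangentEquiv_naturality`**: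
  `Φ' ∘ (T ⊗ w_g) = w_{g_Y} ∘ Φ`; §4 the linear-algebra closing lemma `charpoly_eq_map_of_baseChange_comm` (`δ ∘ Φ = Φ ∘ (T ⊗ γ)` ⇒
  `δ.charpoly = γ.charpoly.map (R → T)`, Mathlib `LinearMap.charpoly_baseChange` + `LinearEquiv.charpoly_conj`) with the `Module.Free/Finite` transports.

## References
* [GortzWedhorn2023] U. Görtz, T. Wedhorn, *Algebraic Geometry II* (2023): Remark 17.14, Remark 17.15 (1), (17.3).
* [EGAIV4] A. Grothendieck, *EGA IV₄*, Publ. Math. IHÉS 32 (1967): (16.2.3 (ii)), (16.4.9).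
* [GortzWedhorn2020] U. Görtz, T. Wedhorn, *Algebraic Geometry I*, 2nd ed. (2020): Remark 6.12 (2)–(3).
* [StacksProject] The Stacks Project, Tag 00RU.
-/

set_option autoImplicit false

noncomputable section

open TensorProduct

universe u v w

namespace Literature.RingTheory.Smooth

/-! ## §1 Naturality of `T ⊗_R I/I² ≅ I_T/I_T²` in an augmented homomorphism `(S, ε) → (S', ε')` -/

section Hom

variable {R : Type u} [CommRing R] {S S' : Type v} [CommRing S] [CommRing S'] [Algebra R S] [Algebra R S']
  (ε : S →ₐ[R] R) (ε' : S' →ₐ[R] R) (T : Type w) [CommRing T] [Algebra R T]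

variable {ε ε'} in
/-- An `R`-algebra map `g : S → S'` compatible with the augmentations (`ε' ∘ g = ε`) maps `I = ker ε` into `I' = ker ε'` (the commutative square of the
two sections, [GortzWedhorn2023] Remark 17.14). [cite: GortzWedhorn2023, Remark 17.14] -/
theorem augIdeal_le_comap_of_comp_eq {g : S →ₐ[R] S'} (hg : ε'.comp g = ε) : augIdeal ε ≤ (augIdeal ε').comap g := by
  intro x hx
  rw [Ideal.mem_comap, mem_augIdeal_iff, ← AlgHom.comp_apply, hg]
  exact (mem_augIdeal_iff ε x).1 hx

/-- The base change `g_T = T ⊗ g` is compatible with the base-changed augmentations: `ε'_T ∘ g_T = ε_T`. [cite: EGAIV4, (16.2.3) and (16.4.9)] -/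
theorem baseChangeAugmentation_comp_map (g : S →ₐ[R] S') (hg : ε'.comp g = ε) :
    (baseChangeAugmentation ε' T).comp (Algebra.TensorProduct.map (AlgHom.id T T) g) = baseChangeAugmentation ε T := by
  refine AlgHom.ext fun z => ?_
  induction z using TensorProduct.induction_on with
  | zero => simp only [map_zero]
  | tmul t s =>
    rw [AlgHom.comp_apply, Algebra.TensorProduct.map_tmul, AlgHom.id_apply, baseChangeAugmentation_tmul, baseChangeAugmentation_tmul,
      ← AlgHom.comp_apply ε' g, hg]
  | add x y hx hy => simp only [map_add, hx, hy]

/-- `g_T` maps `I_T` into `I'_T`. [cite: EGAIV4, (16.2.3) and (16.4.9)] -/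
theorem augIdealBaseChange_le_comap_map_of_comp_eq (g : S →ₐ[R] S') (hg : ε'.comp g = ε) :
    augIdealBaseChange ε T ≤ (augIdealBaseChange ε' T).comap (Algebra.TensorProduct.map (AlgHom.id T T) g) := by
  rw [augIdealBaseChange, Ideal.map_le_iff_le_comap]
  intro x hx
  rw [Ideal.mem_comap, Ideal.mem_comap, AlgHom.toRingHom_eq_coe, RingHom.coe_coe, Algebra.TensorProduct.includeRight_apply,
    Algebra.TensorProduct.map_tmul, AlgHom.id_apply]
  exact one_tmul_mem_augIdealBaseChange ε' T ⟨g x, augIdeal_le_comap_of_comp_eq hg hx⟩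

/-- **Naturality of `T ⊗_R I/I² ≅ I_T/I_T²` in an augmented homomorphism `g : (S, ε) → (S', ε')`**: the base change of `w_g = Ideal.mapCotangent g :
I/I² → I'/I'²` is `w_{g_T}` on `I_T/I_T² → I'_T/I'_T²`. (★ `tensorCotangentEquivOfAugmentation_naturality` is the case `S = S'`, `ε = ε'`.)
[cite: GortzWedhorn2023, Remark 17.14 and Remark 17.15 (1)] [cite: EGAIV4, (16.2.3) and (16.4.9)] -/
theorem tensorCotangentEquivOfAugmentation_naturality_hom (g : S →ₐ[R] S') (hg : ε'.comp g = ε) (z : T ⊗[R] (augIdeal ε).Cotangent) :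
    tensorCotangentEquivOfAugmentation ε' T (((augIdeal ε).mapCotangent (augIdeal ε') g (augIdeal_le_comap_of_comp_eq hg)).baseChange T z) =
      (augIdealBaseChange ε T).mapCotangent (augIdealBaseChange ε' T) (Algebra.TensorProduct.map (AlgHom.id T T) g)
        (augIdealBaseChange_le_comap_map_of_comp_eq ε ε' T g hg) (tensorCotangentEquivOfAugmentation ε T z) := by
  induction z using TensorProduct.induction_on with
  | zero => simp only [map_zero]
  | tmul t x =>
    obtain ⟨x, rfl⟩ := (augIdeal ε).toCotangent_surjective x
    rw [LinearMap.baseChange_tmul, Ideal.mapCotangent_toCotangent, tensorCotangentEquivOfAugmentation_tmul,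
      tensorCotangentEquivOfAugmentation_tmul, map_smul, Ideal.mapCotangent_toCotangent]
    congr 2
  | add x y hx hy => simp only [map_add, hx, hy]

/-- The same naturality as an identity of `T`-linear maps. [cite: GortzWedhorn2023, Remark 17.14 and Remark 17.15 (1)] -/
theorem mapCotangent_comp_tensorCotangentEquivOfAugmentation (g : S →ₐ[R] S') (hg : ε'.comp g = ε) :
    (augIdealBaseChange ε T).mapCotangent (augIdealBaseChange ε' T) (Algebra.TensorProduct.map (AlgHom.id T T) g)
        (augIdealBaseChange_le_comap_map_of_comp_eq ε ε' T g hg) ∘ₗ (tensorCotangentEquivOfAugmentation ε T).toLinearMap =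
      (tensorCotangentEquivOfAugmentation ε' T).toLinearMap ∘ₗ
        ((augIdeal ε).mapCotangent (augIdeal ε') g (augIdeal_le_comap_of_comp_eq hg)).baseChange T := by
  refine LinearMap.ext fun z => ?_
  rw [LinearMap.comp_apply, LinearMap.comp_apply, LinearEquiv.coe_toLinearMap, LinearEquiv.coe_toLinearMap,
    tensorCotangentEquivOfAugmentation_naturality_hom ε ε' T g hg]

end Hom

/-! ## §2 Transport of `I/I²` along an algebra ISOMORPHISM -/

section AlgEquiv

variable {A : Type u} [CommRing A] {B₁ B₂ : Type v} [CommRing B₁] [CommRing B₂] [Algebra A B₁] [Algebra A B₂]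
  (I₁ : Ideal B₁) (I₂ : Ideal B₂) (Θ : B₁ ≃ₐ[A] B₂) (h₁ : I₁ ≤ I₂.comap (Θ : B₁ →ₐ[A] B₂)) (h₂ : I₂ ≤ I₁.comap (Θ.symm : B₂ →ₐ[A] B₁))

/-- **`I₁/I₁² ≃ₗ[A] I₂/I₂²` along an `A`-algebra isomorphism `Θ : B₁ ≅ B₂` with `Θ(I₁) ⊆ I₂`, `Θ⁻¹(I₂) ⊆ I₁`** (`Ideal.mapCotangent Θ` with inverse
`Ideal.mapCotangent Θ⁻¹`). [cite: GortzWedhorn2023, Remark 17.14] -/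
def cotangentEquivOfAlgEquiv : I₁.Cotangent ≃ₗ[A] I₂.Cotangent :=
  LinearEquiv.ofLinear (I₁.mapCotangent I₂ (Θ : B₁ →ₐ[A] B₂) h₁) (I₂.mapCotangent I₁ (Θ.symm : B₂ →ₐ[A] B₁) h₂)
    (by
      refine LinearMap.ext fun y => ?_
      obtain ⟨y, rfl⟩ := I₂.toCotangent_surjective y
      rw [LinearMap.comp_apply, Ideal.mapCotangent_toCotangent, Ideal.mapCotangent_toCotangent, LinearMap.id_apply]
      congr 1
      exact Subtype.ext (Θ.apply_symm_apply (y : B₂)))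
    (by
      refine LinearMap.ext fun x => ?_
      obtain ⟨x, rfl⟩ := I₁.toCotangent_surjective x
      rw [LinearMap.comp_apply, Ideal.mapCotangent_toCotangent, Ideal.mapCotangent_toCotangent, LinearMap.id_apply]
      congr 1
      exact Subtype.ext (Θ.symm_apply_apply (x : B₁)))

/-- `cotangentEquivOfAlgEquiv [x] = [Θ x]`. [cite: GortzWedhorn2023, Remark 17.14] -/
theorem cotangentEquivOfAlgEquiv_toCotangent (x : I₁) :
    cotangentEquivOfAlgEquiv I₁ I₂ Θ h₁ h₂ (I₁.toCotangent x) = I₂.toCotangent ⟨Θ x, h₁ x.2⟩ :=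
  Ideal.mapCotangent_toCotangent _ _ _ _ _

/-- `cotangentEquivOfAlgEquiv` IS `Ideal.mapCotangent Θ` (as a linear map). [cite: GortzWedhorn2023, Remark 17.14] -/
theorem cotangentEquivOfAlgEquiv_toLinearMap :
    (cotangentEquivOfAlgEquiv I₁ I₂ Θ h₁ h₂).toLinearMap = I₁.mapCotangent I₂ (Θ : B₁ →ₐ[A] B₂) h₁ :=
  rfl

/-- `(cotangentEquivOfAlgEquiv Θ)⁻¹ [y] = [Θ⁻¹ y]`. [cite: GortzWedhorn2023, Remark 17.14] -/
theorem cotangentEquivOfAlgEquiv_symm_toCotangent (y : I₂) :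
    (cotangentEquivOfAlgEquiv I₁ I₂ Θ h₁ h₂).symm (I₂.toCotangent y) = I₁.toCotangent ⟨Θ.symm y, h₂ y.2⟩ :=
  Ideal.mapCotangent_toCotangent _ _ _ _ _

/-- **Naturality square of the transport**: for isomorphisms `Θ : B₁ ≅ B₂`, `Θ' : B₁' ≅ B₂'` and homs `g₁ : B₁ → B₁'`, `g₂ : B₂ → B₂'` with
`Θ' ∘ g₁ = g₂ ∘ Θ` (all respecting the ideals), the maps `w = Ideal.mapCotangent` commute with the transports: `Φ' (w_{g₁} x) = w_{g₂} (Φ x)`.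
[cite: GortzWedhorn2023, Remark 17.14] -/
theorem cotangentEquivOfAlgEquiv_naturality {B₁' B₂' : Type v} [CommRing B₁'] [CommRing B₂'] [Algebra A B₁'] [Algebra A B₂']
    (I₁' : Ideal B₁') (I₂' : Ideal B₂') (Θ' : B₁' ≃ₐ[A] B₂') (h₁' : I₁' ≤ I₂'.comap (Θ' : B₁' →ₐ[A] B₂'))
    (h₂' : I₂' ≤ I₁'.comap (Θ'.symm : B₂' →ₐ[A] B₁')) (g₁ : B₁ →ₐ[A] B₁') (hg₁ : I₁ ≤ I₁'.comap g₁) (g₂ : B₂ →ₐ[A] B₂') (hg₂ : I₂ ≤ I₂'.comap g₂)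
    (hsq : ∀ x : B₁, Θ' (g₁ x) = g₂ (Θ x)) (x : I₁.Cotangent) :
    cotangentEquivOfAlgEquiv I₁' I₂' Θ' h₁' h₂' (I₁.mapCotangent I₁' g₁ hg₁ x) =
      I₂.mapCotangent I₂' g₂ hg₂ (cotangentEquivOfAlgEquiv I₁ I₂ Θ h₁ h₂ x) := by
  obtain ⟨x, rfl⟩ := I₁.toCotangent_surjective x
  rw [Ideal.mapCotangent_toCotangent, cotangentEquivOfAlgEquiv_toCotangent, cotangentEquivOfAlgEquiv_toCotangent, Ideal.mapCotangent_toCotangent]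
  congr 1
  exact Subtype.ext (hsq (x : B₁))

end AlgEquiv

/-! ## §3 The master square: base change of `w_g` along augmented chart isomorphisms -/

section Master

variable {R : Type u} [CommRing R] {S S' : Type u} [CommRing S] [CommRing S'] [Algebra R S] [Algebra R S']
  (ε : S →ₐ[R] R) (ε' : S' →ₐ[R] R) (T : Type u) [CommRing T] [Algebra R T]
  {SY SY' : Type u} [CommRing SY] [CommRing SY'] [Algebra T SY] [Algebra T SY'] (εY : SY →ₐ[T] T) (εY' : SY' →ₐ[T] T)
  (Θ : T ⊗[R] S ≃ₐ[T] SY) (hΘ : εY.comp (Θ : T ⊗[R] S →ₐ[T] SY) = baseChangeAugmentation ε T)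
  (Θ' : T ⊗[R] S' ≃ₐ[T] SY') (hΘ' : εY'.comp (Θ' : T ⊗[R] S' →ₐ[T] SY') = baseChangeAugmentation ε' T)

include hΘ in
/-- An augmented chart isomorphism maps `I_T` into `I_Y = ker ε_Y`. [cite: GortzWedhorn2023, Remark 17.15 (1)] -/
theorem augIdealBaseChange_le_comap_algEquiv : augIdealBaseChange ε T ≤ (augIdeal εY).comap (Θ : T ⊗[R] S →ₐ[T] SY) := by
  intro x hx
  rw [Ideal.mem_comap, mem_augIdeal_iff, ← AlgHom.comp_apply, hΘ]
  exact baseChangeAugmentation_eq_zero_of_mem ε T hx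

include hΘ in
/-- … and its inverse maps `I_Y` into `I_T` (★ `ker_baseChangeAugmentation`). [cite: GortzWedhorn2023, Remark 17.15 (1)] -/
theorem augIdeal_le_comap_algEquiv_symm : augIdeal εY ≤ (augIdealBaseChange ε T).comap (Θ.symm : SY →ₐ[T] T ⊗[R] S) := by
  intro y hy
  rw [Ideal.mem_comap]
  have hker : Θ.symm y ∈ RingHom.ker (baseChangeAugmentation ε T).toRingHom := by
    rw [RingHom.mem_ker, AlgHom.toRingHom_eq_coe, RingHom.coe_coe, ← hΘ, AlgHom.comp_apply]
    change εY (Θ (Θ.symm y)) = 0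
    rw [AlgEquiv.apply_symm_apply]
    exact (mem_augIdeal_iff εY y).1 hy
  rwa [ker_baseChangeAugmentation] at hker

/-- **`Φ : T ⊗_R I/I² ≃ₗ[T] I_Y/I_Y²`** for an augmented `T`-algebra isomorphism `Θ : T ⊗_R S ≅ S_Y` (`ε_Y ∘ Θ = ε_T`): ★ `tensorCotangentEquivOfAugmentation`
followed by the transport `cotangentEquivOfAlgEquiv Θ` — the shape in which «the conormal module of a section commutes with base change» is consumed
on a chart `Γ(X_T, p⁻¹W) ≅ T ⊗_R Γ(X, W)`. [cite: GortzWedhorn2023, Remark 17.15 (1)] [cite: EGAIV4, (16.2.3) and (16.4.9)] -/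
def baseChangeCotangentEquiv : T ⊗[R] (augIdeal ε).Cotangent ≃ₗ[T] (augIdeal εY).Cotangent :=
  (tensorCotangentEquivOfAugmentation ε T).trans (cotangentEquivOfAlgEquiv (augIdealBaseChange ε T) (augIdeal εY) Θ
    (augIdealBaseChange_le_comap_algEquiv ε T εY Θ hΘ) (augIdeal_le_comap_algEquiv_symm ε T εY Θ hΘ))

/-- `Φ (a ⊗ [x]) = a • [Θ (1 ⊗ x)]`. [cite: GortzWedhorn2023, Remark 17.15 (1)] -/
theorem baseChangeCotangentEquiv_tmul (a : T) (x : augIdeal ε) :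
    baseChangeCotangentEquiv ε T εY Θ hΘ (a ⊗ₜ[R] (augIdeal ε).toCotangent x) =
      a • (augIdeal εY).toCotangent ⟨Θ ((1 : T) ⊗ₜ[R] (x : S)),
        augIdealBaseChange_le_comap_algEquiv ε T εY Θ hΘ (one_tmul_mem_augIdealBaseChange ε T x)⟩ := by
  rw [baseChangeCotangentEquiv, LinearEquiv.trans_apply, tensorCotangentEquivOfAugmentation_tmul, map_smul, cotangentEquivOfAlgEquiv_toCotangent]

/-- **THE MASTER SQUARE.**  For augmented homs `g : (S, ε) → (S', ε')` over `R` and `g_Y : (S_Y, ε_Y) → (S_Y', ε_Y')` over `T` intertwined by the chart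
isomorphisms (`Θ' (T ⊗ g) = g_Y Θ`): `Φ' ((T ⊗ w_g) z) = w_{g_Y} (Φ z)` — base change of the map `w` of conormal modules ([GortzWedhorn2023] Rem. 17.14) is the
map `w` of the base-changed square. [cite: GortzWedhorn2023, Remark 17.14 and Remark 17.15 (1)] [cite: EGAIV4, (16.2.3) and (16.4.9)] -/
theorem baseChangeCotangentEquiv_naturality (g : S →ₐ[R] S') (hg : ε'.comp g = ε) (gY : SY →ₐ[T] SY') (hgY : εY'.comp gY = εY)
    (hsq : ∀ z : T ⊗[R] S, Θ' (Algebra.TensorProduct.map (AlgHom.id T T) g z) = gY (Θ z)) (z : T ⊗[R] (augIdeal ε).Cotangent) :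
    baseChangeCotangentEquiv ε' T εY' Θ' hΘ' (((augIdeal ε).mapCotangent (augIdeal ε') g (augIdeal_le_comap_of_comp_eq hg)).baseChange T z) =
      (augIdeal εY).mapCotangent (augIdeal εY') gY (augIdeal_le_comap_of_comp_eq hgY) (baseChangeCotangentEquiv ε T εY Θ hΘ z) := by
  rw [baseChangeCotangentEquiv, baseChangeCotangentEquiv, LinearEquiv.trans_apply, LinearEquiv.trans_apply,
    tensorCotangentEquivOfAugmentation_naturality_hom ε ε' T g hg]
  exact cotangentEquivOfAlgEquiv_naturality (augIdealBaseChange ε T) (augIdeal εY) Θ (augIdealBaseChange_le_comap_algEquiv ε T εY Θ hΘ)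
    (augIdeal_le_comap_algEquiv_symm ε T εY Θ hΘ) (augIdealBaseChange ε' T) (augIdeal εY') Θ'
    (augIdealBaseChange_le_comap_algEquiv ε' T εY' Θ' hΘ') (augIdeal_le_comap_algEquiv_symm ε' T εY' Θ' hΘ')
    (Algebra.TensorProduct.map (AlgHom.id T T) g) (augIdealBaseChange_le_comap_map_of_comp_eq ε ε' T g hg) gY
    (augIdeal_le_comap_of_comp_eq hgY) hsq _

/-- The master square as an identity of `T`-linear maps: `w_{g_Y} ∘ Φ = Φ' ∘ (T ⊗ w_g)`. [cite: GortzWedhorn2023, Remark 17.14 and Remark 17.15 (1)] -/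
theorem mapCotangent_comp_baseChangeCotangentEquiv (g : S →ₐ[R] S') (hg : ε'.comp g = ε) (gY : SY →ₐ[T] SY') (hgY : εY'.comp gY = εY)
    (hsq : ∀ z : T ⊗[R] S, Θ' (Algebra.TensorProduct.map (AlgHom.id T T) g z) = gY (Θ z)) :
    (augIdeal εY).mapCotangent (augIdeal εY') gY (augIdeal_le_comap_of_comp_eq hgY) ∘ₗ (baseChangeCotangentEquiv ε T εY Θ hΘ).toLinearMap =
      (baseChangeCotangentEquiv ε' T εY' Θ' hΘ').toLinearMap ∘ₗ
        ((augIdeal ε).mapCotangent (augIdeal ε') g (augIdeal_le_comap_of_comp_eq hg)).baseChange T := by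
  refine LinearMap.ext fun z => ?_
  rw [LinearMap.comp_apply, LinearMap.comp_apply, LinearEquiv.coe_toLinearMap, LinearEquiv.coe_toLinearMap,
    baseChangeCotangentEquiv_naturality ε ε' T εY εY' Θ hΘ Θ' hΘ' g hg gY hgY hsq]

include hΘ in
/-- `Module.Free` transport: `I/I²` free over `R` ⇒ `I_Y/I_Y²` free over `T`. [cite: EGAIV4, (16.2.3) and (16.4.9)] -/
theorem free_of_baseChangeCotangentEquiv [Module.Free R (augIdeal ε).Cotangent] : Module.Free T (augIdeal εY).Cotangent :=
  Module.Free.of_equiv (baseChangeCotangentEquiv ε T εY Θ hΘ)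

include hΘ in
/-- `Module.Finite` transport: `I/I²` finite over `R` ⇒ `I_Y/I_Y²` finite over `T`. [cite: EGAIV4, (16.2.3) and (16.4.9)] -/
theorem finite_of_baseChangeCotangentEquiv [Module.Finite R (augIdeal ε).Cotangent] : Module.Finite T (augIdeal εY).Cotangent :=
  Module.Finite.equiv (baseChangeCotangentEquiv ε T εY Θ hΘ)

end Master

/-! ## §4 The linear-algebra closing lemma -/

section Charpoly

variable {R : Type u} [CommRing R] (T : Type v) [CommRing T] [Algebra R T] {M : Type w} [AddCommGroup M] [Module R M]
  {N : Type w} [AddCommGroup N] [Module T N]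

/-- **If `δ ∘ Φ = Φ ∘ (T ⊗ γ)` for a `T`-linear isomorphism `Φ : T ⊗_R M ≅ N`, then `δ.charpoly = γ.charpoly.map (R → T)`** (`M` free of finite rank
over `R`; `N` is then free of finite rank over `T`; Mathlib `LinearMap.charpoly_baseChange`, `LinearEquiv.charpoly_conj`). [cite: GortzWedhorn2020, Remark 6.12 (2)–(3)] -/
theorem charpoly_eq_map_of_baseChange_comm [Module.Free R M] [Module.Finite R M] (Φ : T ⊗[R] M ≃ₗ[T] N) (γ : M →ₗ[R] M) (δ : N →ₗ[T] N)
    (h : δ ∘ₗ Φ.toLinearMap = Φ.toLinearMap ∘ₗ γ.baseChange T) :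
    haveI := Module.Free.of_equiv Φ
    haveI := Module.Finite.equiv Φ
    δ.charpoly = γ.charpoly.map (algebraMap R T) := by
  haveI := Module.Free.of_equiv Φ
  haveI := Module.Finite.equiv Φ
  have hδ : δ = Φ.conj (γ.baseChange T) := by
    rw [LinearEquiv.conj_apply]
    refine LinearMap.ext fun y => ?_
    obtain ⟨z, rfl⟩ := Φ.surjective y
    have := LinearMap.congr_fun h z
    rw [LinearMap.comp_apply, LinearMap.comp_apply, LinearEquiv.coe_toLinearMap] at this
    rw [LinearMap.comp_apply, LinearMap.comp_apply, LinearEquiv.coe_coe, LinearEquiv.coe_coe, LinearEquiv.symm_apply_apply, this]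
  rw [hδ, LinearEquiv.charpoly_conj, LinearMap.charpoly_baseChange]

end Charpoly

end Literature.RingTheory.Smooth

end
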